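import Summits.CriticalPhenomena.SAWScalingLimit.Theorems.SAWDefectDecoherenceBoundaryClosureRInnerZigzagEdges
import Summits.CriticalPhenomena.SAWScalingLimit.Theorems.SAWDefectDecoherenceBoundaryClosureRInnerPolygonsBoundaryPolygon
import Summits.CriticalPhenomena.SAWScalingLimit.Theorems.SAWDefectDecoherenceBoundaryClosureRInnerPolygonsFan
import HarnessLib

/-!
# Crux `BoundaryClosureR` (stmt-CriticalPhenomena-14004), line `polygon-parity-squeeze`,
# stub `stub_innerZigzagPolygon` (7a): the inside and the outside of the boundary cycle of a
# pinch-free face set, face by face along the boundary walk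

Landing target:
`Summits/CriticalPhenomena/SAWScalingLimit/Theorems/SAWDefectDecoherenceBoundaryClosureRInnerZigzagInside.lean`
(`--supports stmt-CriticalPhenomena-14004`; building block C1 of the registered stub
`stub_innerZigzagPolygon`, the continuum half of the inner-polygon construction (IP)).

`K` a pinch-free finite face set of `𝕋`, `d₀` a boundary dart, `Per` a period of its left-hand boundary
walk spanning a simple closed polygon (`…InnerPolygonsBoundaryPolygon`), `P` its `polygonDomain`,
`Γ = frontier P` the cycle, `V` the outside (`P ⊔ V = Γᶜ`, `frontier V = Γ`, the tree's Jordan curve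
theorem).  Inside and outside are identified FACE BY FACE (no connectivity of cell unions):

* `mem_frontier_iff`, `exists_cells_of_mem_frontier` — `Γ` is the union of the closed edges of the
  darts; every point of `Γ` lies in the closed cell of a `K`-face and of a non-`K`-face;
* `triCellStrict_disjoint_frontier` (`open_cells_miss_cycle`), `openRhombus_disjoint_frontier` — open
  cells miss `Γ`, and so does the open rhombus of two adjacent faces both in `K` or both off `K`;
* `subset_carrier_or_outside` and the four STEP lemmas — a convex set missing `Γ` is inside or
  outside; adjacent faces on the same side of `K` are on the same side of `Γ`;
* `leftFace_inside`, `fan_inside` — if the left face of `d₀` is inside, by induction along the walk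
  (through the fan at each head) every `K`-face at every vertex of the cycle is inside;
* `rightFace_outside`, `fan_outside` — the right face of every dart is outside (read at the midpoint
  of its edge, a point of `frontier V`, with `edge_trichotomy`), hence so is every non-`K` face.

Sources: folklore; J. McCleary, *A First Course in Topology* (2006), Ch. 9 (Jordan curve theorem, via
the tree's `polygonDomain`).  No definition and no named fact is introduced. -/

noncomputable section

open scoped ComplexConjugate
open Set Metric
open Literature.Probability.LatticeModels
open Literature.Probability.Percolation (triX triY triCell triCellStrict triDir eq_of_mem_triCellStrict_of_mem_triCell)
open Literature.Probability.RandomPlanarGeometry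
open Summit.CriticalPhenomena.SAWScalingLimit.Theorems.PolygonParitySqueeze.BoundaryWalk

namespace Summit.CriticalPhenomena.SAWScalingLimit.Theorems.PolygonParitySqueeze.InnerZigzag

variable {K : Finset HexVertex} {d₀ : Site 2 × Fin 6} {Per : ℕ}

/-! ### 1. The cycle -/
/-- **The cycle is the union of the closed edges of the darts of the walk.** [folklore] -/
theorem mem_frontier_iff (hs : IsSimpleClosedPolygon (bverts K 0 1 d₀ Per)) (h₀ : d₀ ∈ bdDarts K)
    (hPd : bwalk K d₀ Per = d₀) {z : ℂ} :
    z ∈ frontier (polygonDomain (bverts K 0 1 d₀ Per) hs).carrier ↔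
      ∃ t < Per, z ∈ segment ℝ (triEmbed (bwalk K d₀ t).1) (triEmbed ((bwalk K d₀ t).1 + triDir (bwalk K d₀ t).2)) := by
  rw [frontier_polygonDomain, Set.mem_iUnion]
  have hlen : (bverts K 0 1 d₀ Per).length = Per := length_bverts _ _ _ _
  have key : ∀ (t : ℕ) (ht : t < (bverts K 0 1 d₀ Per).length), segment ℝ ((bverts K 0 1 d₀ Per)[t])
      ((bverts K 0 1 d₀ Per)[(t + 1) % (bverts K 0 1 d₀ Per).length]'(Nat.mod_lt _ (by omega))) =
        segment ℝ (triEmbed (bwalk K d₀ t).1) (triEmbed ((bwalk K d₀ t).1 + triDir (bwalk K d₀ t).2)) := by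
    intro t ht
    rw [getElem_bverts, getElem_bverts, length_bverts, bwalk_mod_period hPd, bwalk_fst_succ h₀]; simp
  constructor
  · rintro ⟨k, hk⟩
    exact ⟨k, by simpa [hlen] using k.2, by rwa [key k k.2] at hk⟩
  · rintro ⟨t, ht, hz⟩
    refine ⟨⟨t, by rw [hlen]; exact ht⟩, ?_⟩
    show z ∈ segment ℝ ((bverts K 0 1 d₀ Per)[t]) _
    rwa [key t (by rw [hlen]; exact ht)]

/-- **Every point of the cycle lies in the closed cells of the left face (in `K`) and of the right face
(off `K`) of a dart of the walk.** [folklore] -/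
theorem exists_cells_of_mem_frontier (hs : IsSimpleClosedPolygon (bverts K 0 1 d₀ Per)) (h₀ : d₀ ∈ bdDarts K)
    (hPd : bwalk K d₀ Per = d₀) {z : ℂ} (hz : z ∈ frontier (polygonDomain (bverts K 0 1 d₀ Per) hs).carrier) :
    ∃ t < Per, z ∈ triCell (faceL (bwalk K d₀ t).1 (bwalk K d₀ t).2) ∧
      z ∈ triCell (faceL (bwalk K d₀ t).1 ((bwalk K d₀ t).2 + 5)) ∧
      faceL (bwalk K d₀ t).1 (bwalk K d₀ t).2 ∈ K ∧ faceL (bwalk K d₀ t).1 ((bwalk K d₀ t).2 + 5) ∉ K := by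
  obtain ⟨t, ht, hzt⟩ := (mem_frontier_iff hs h₀ hPd).1 hz
  exact ⟨t, ht, edge_subset_triCell_left _ _ hzt, edge_subset_triCell_right _ _ hzt, mem_bdDarts.1 (isBdDart_bwalk h₀ t)⟩

/-- **Open cells miss the cycle.** [folklore] -/
theorem triCellStrict_disjoint_frontier (hs : IsSimpleClosedPolygon (bverts K 0 1 d₀ Per)) (h₀ : d₀ ∈ bdDarts K)
    (hPd : bwalk K d₀ Per = d₀) (G : HexVertex) :
    Disjoint (triCellStrict G) (frontier (polygonDomain (bverts K 0 1 d₀ Per) hs).carrier) := by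
  rw [Set.disjoint_left]
  intro z hzG hzΓ
  obtain ⟨t, -, hzL, hzR, hL, hR⟩ := exists_cells_of_mem_frontier hs h₀ hPd hzΓ
  rw [← eq_of_mem_triCellStrict_of_mem_triCell hzG hzL] at hL
  rw [← eq_of_mem_triCellStrict_of_mem_triCell hzG hzR] at hR
  exact hR hL

/-- **The open rhombus of two adjacent faces, both in `K` or both off `K`, misses the cycle.**
[folklore] -/
theorem openRhombus_disjoint_frontier (hs : IsSimpleClosedPolygon (bverts K 0 1 d₀ Per)) (h₀ : d₀ ∈ bdDarts K)
    (hPd : bwalk K d₀ Per = d₀) (y : Site 2) (i : Fin 6)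
    (hKK : (faceL y i ∈ K ∧ faceL y (i + 1) ∈ K) ∨ (faceL y i ∉ K ∧ faceL y (i + 1) ∉ K)) :
    Disjoint (openRhombus y i) (frontier (polygonDomain (bverts K 0 1 d₀ Per) hs).carrier) := by
  rw [Set.disjoint_left]
  intro z hzR hzΓ
  obtain ⟨t, -, hzL, hzR', hL, hR⟩ := exists_cells_of_mem_frontier hs h₀ hPd hzΓ
  rcases hKK with ⟨h1, h2⟩ | ⟨h1, h2⟩
  · rcases eq_faceL_of_mem_openRhombus y i z _ hzR hzR' with e | e <;> rw [e] at hR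
    · exact hR h1
    · exact hR h2
  · rcases eq_faceL_of_mem_openRhombus y i z _ hzR hzL with e | e <;> rw [e] at hL
    · exact h1 hL
    · exact h2 hL

/-! ### 2. Inside or outside -/

section Sides

variable (hs : IsSimpleClosedPolygon (bverts K 0 1 d₀ Per)) (h₀ : d₀ ∈ bdDarts K) (hPd : bwalk K d₀ Per = d₀)
  {V : Set ℂ} (hV : IsOpen V ∧ Disjoint (polygonDomain (bverts K 0 1 d₀ Per) hs).carrier V ∧
    (polygonDomain (bverts K 0 1 d₀ Per) hs).carrier ∪ V = (frontier (polygonDomain (bverts K 0 1 d₀ Per) hs).carrier)ᶜ ∧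
    frontier V = frontier (polygonDomain (bverts K 0 1 d₀ Per) hs).carrier)

include hV in
/-- **A preconnected set missing the cycle is inside or outside.** [folklore] -/
theorem subset_carrier_or_outside {C : Set ℂ} (hC : IsPreconnected C)
    (hCΓ : Disjoint C (frontier (polygonDomain (bverts K 0 1 d₀ Per) hs).carrier)) :
    C ⊆ (polygonDomain (bverts K 0 1 d₀ Per) hs).carrier ∨ C ⊆ V := by
  refine hC.subset_or_subset (polygonDomain _ hs).isOpen hV.1 hV.2.1 ?_
  rw [hV.2.2.1]
  exact Set.disjoint_left.1 hCΓ

include hV in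
/-- A convex set missing the cycle and meeting the inside is inside. [folklore] -/
theorem subset_carrier_of_convex {C : Set ℂ} (hC : Convex ℝ C)
    (hCΓ : Disjoint C (frontier (polygonDomain (bverts K 0 1 d₀ Per) hs).carrier))
    (hmeet : (C ∩ (polygonDomain (bverts K 0 1 d₀ Per) hs).carrier).Nonempty) :
    C ⊆ (polygonDomain (bverts K 0 1 d₀ Per) hs).carrier := by
  rcases subset_carrier_or_outside hs hV hC.isPreconnected hCΓ with h | h
  · exact h
  · obtain ⟨z, hzC, hzP⟩ := hmeet
    exact absurd (h hzC) (Set.disjoint_left.1 hV.2.1 hzP)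

include hV in
/-- A convex set missing the cycle and meeting the outside is outside. [folklore] -/
theorem subset_outside_of_convex {C : Set ℂ} (hC : Convex ℝ C)
    (hCΓ : Disjoint C (frontier (polygonDomain (bverts K 0 1 d₀ Per) hs).carrier)) (hmeet : (C ∩ V).Nonempty) :
    C ⊆ V := by
  rcases subset_carrier_or_outside hs hV hC.isPreconnected hCΓ with h | h
  · obtain ⟨z, hzC, hzV⟩ := hmeet
    exact absurd (h hzC) (Set.disjoint_right.1 hV.2.1 hzV)
  · exact h

include h₀ hPd hV in
/-- **Inside step**: two adjacent `K`-faces are inside together (down the fan). [folklore] -/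
theorem inside_step_down (y : Site 2) (i : Fin 6) (h1 : faceL y i ∈ K) (h2 : faceL y (i + 1) ∈ K)
    (hin : triCellStrict (faceL y (i + 1)) ⊆ (polygonDomain (bverts K 0 1 d₀ Per) hs).carrier) :
    triCellStrict (faceL y i) ⊆ (polygonDomain (bverts K 0 1 d₀ Per) hs).carrier := by
  have hsub := subset_carrier_of_convex hs hV (convex_openRhombus y i)
    (openRhombus_disjoint_frontier hs h₀ hPd y i (Or.inl ⟨h1, h2⟩))
    ⟨_, (triCellStrict_subset_openRhombus y i).2 (hexCenter_mem_triCellStrict _), hin (hexCenter_mem_triCellStrict _)⟩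
  exact (triCellStrict_subset_openRhombus y i).1.trans hsub

include h₀ hPd hV in
/-- **Inside step**: two adjacent `K`-faces are inside together (up the fan). [folklore] -/
theorem inside_step_up (y : Site 2) (i : Fin 6) (h1 : faceL y i ∈ K) (h2 : faceL y (i + 1) ∈ K)
    (hin : triCellStrict (faceL y i) ⊆ (polygonDomain (bverts K 0 1 d₀ Per) hs).carrier) :
    triCellStrict (faceL y (i + 1)) ⊆ (polygonDomain (bverts K 0 1 d₀ Per) hs).carrier := by
  have hsub := subset_carrier_of_convex hs hV (convex_openRhombus y i)
    (openRhombus_disjoint_frontier hs h₀ hPd y i (Or.inl ⟨h1, h2⟩))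
    ⟨_, (triCellStrict_subset_openRhombus y i).1 (hexCenter_mem_triCellStrict _), hin (hexCenter_mem_triCellStrict _)⟩
  exact (triCellStrict_subset_openRhombus y i).2.trans hsub

include h₀ hPd hV in
/-- **Outside step**: two adjacent non-`K`-faces are outside together (down). [folklore] -/
theorem outside_step_down (y : Site 2) (i : Fin 6) (h1 : faceL y i ∉ K) (h2 : faceL y (i + 1) ∉ K)
    (hout : triCellStrict (faceL y (i + 1)) ⊆ V) : triCellStrict (faceL y i) ⊆ V := by
  have hsub := subset_outside_of_convex hs hV (convex_openRhombus y i)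
    (openRhombus_disjoint_frontier hs h₀ hPd y i (Or.inr ⟨h1, h2⟩))
    ⟨_, (triCellStrict_subset_openRhombus y i).2 (hexCenter_mem_triCellStrict _), hout (hexCenter_mem_triCellStrict _)⟩
  exact (triCellStrict_subset_openRhombus y i).1.trans hsub

include h₀ hPd hV in
/-- **Outside step**: two adjacent non-`K`-faces are outside together (up). [folklore] -/
theorem outside_step_up (y : Site 2) (i : Fin 6) (h1 : faceL y i ∉ K) (h2 : faceL y (i + 1) ∉ K)
    (hout : triCellStrict (faceL y i) ⊆ V) : triCellStrict (faceL y (i + 1)) ⊆ V := by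
  have hsub := subset_outside_of_convex hs hV (convex_openRhombus y i)
    (openRhombus_disjoint_frontier hs h₀ hPd y i (Or.inr ⟨h1, h2⟩))
    ⟨_, (triCellStrict_subset_openRhombus y i).1 (hexCenter_mem_triCellStrict _), hout (hexCenter_mem_triCellStrict _)⟩
  exact (triCellStrict_subset_openRhombus y i).2.trans hsub

/-- `Fin 6` bookkeeping round a vertex. [folklore] -/
theorem fin6_succ (k : Fin 6) : k + 1 + 1 = k + 2 ∧ k + 2 + 1 = k + 3 ∧ k + 3 + 1 = k + 4 ∧ k + 4 + 1 = k + 5 ∧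
    k + 5 + 1 = k ∧ k + 0 = k :=
  ⟨by rw [add_assoc]; rfl, by rw [add_assoc]; rfl, by rw [add_assoc]; rfl, by rw [add_assoc]; rfl,
    by rw [add_assoc, show (5 : Fin 6) + 1 = 0 from rfl, add_zero], add_zero k⟩

/-! ### 3. The `K`-faces along the cycle are inside -/

include h₀ hPd hV in
/-- **The fan at a head is inside once its top face is**: at the head `y = x + triDir k` of a boundary
dart `(x, k)` of the pinch-free `K`, if the open cell of `faceL y (k+2)` (the left face of the dart)
is inside then so is the open cell of every `K`-face round `y`. [folklore] -/
theorem fan_inside_of_top (hK : ∀ y : Site 2, (Finset.univ.filter fun k : Fin 6 => faceL y k ∈ K ∧ faceL y (k + 1) ∉ K).card ≤ 1)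
    {x : Site 2} {k : Fin 6} (hd : (x, k) ∈ bdDarts K)
    (htop : triCellStrict (faceL (x + triDir k) (k + 2)) ⊆ (polygonDomain (bverts K 0 1 d₀ Per) hs).carrier) :
    ∀ i : Fin 6, faceL (x + triDir k) i ∈ K →
      triCellStrict (faceL (x + triDir k) i) ⊆ (polygonDomain (bverts K 0 1 d₀ Per) hs).carrier := by
  set y := x + triDir k with hy
  obtain ⟨e11, -, -, e41, e51, e0⟩ := fin6_succ k
  obtain ⟨hK2, hK3, hcases⟩ := fan_at_head hK hd
  -- the faces `k+1, k, k+5, k+4` as far as they are in `K`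
  have s1 : faceL y (k + 1) ∈ K → triCellStrict (faceL y (k + 1)) ⊆ (polygonDomain (bverts K 0 1 d₀ Per) hs).carrier :=
    fun h1 => inside_step_down hs h₀ hPd hV y (k + 1) h1 (by rw [e11]; exact hK2) (by rw [e11]; exact htop)
  have s0 : faceL y (k + 1) ∈ K → faceL y k ∈ K → triCellStrict (faceL y k) ⊆ (polygonDomain (bverts K 0 1 d₀ Per) hs).carrier :=
    fun h1 h0 => inside_step_down hs h₀ hPd hV y k h0 h1 (s1 h1)
  have s5 : faceL y (k + 1) ∈ K → faceL y k ∈ K → faceL y (k + 5) ∈ K →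
      triCellStrict (faceL y (k + 5)) ⊆ (polygonDomain (bverts K 0 1 d₀ Per) hs).carrier :=
    fun h1 h0 h5 => inside_step_down hs h₀ hPd hV y (k + 5) h5 (by rw [e51]; exact h0) (by rw [e51]; exact s0 h1 h0)
  have s4 : faceL y (k + 1) ∈ K → faceL y k ∈ K → faceL y (k + 5) ∈ K → faceL y (k + 4) ∈ K →
      triCellStrict (faceL y (k + 4)) ⊆ (polygonDomain (bverts K 0 1 d₀ Per) hs).carrier :=
    fun h1 h0 h5 h4 => inside_step_down hs h₀ hPd hV y (k + 4) h4 (by rw [e41]; exact h5) (by rw [e41]; exact s5 h1 h0 h5)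
  intro i hi
  obtain ⟨c, rfl⟩ : ∃ c : Fin 6, i = k + c := ⟨i - k, by abel⟩
  have hc : c = 0 ∨ c = 1 ∨ c = 2 ∨ c = 3 ∨ c = 4 ∨ c = 5 := by fin_cases c <;> simp
  rcases hc with rfl | rfl | rfl | rfl | rfl | rfl
  · rw [e0] at hi ⊢
    rcases hcases with h | h | h | h | h
    · exact absurd hi h.2.2.1
    · exact absurd hi h.2.2.1
    · exact s0 h.2.1 hi
    · exact s0 h.2.1 hi
    · exact s0 h.2.1 hi
  · rcases hcases with h | h | h | h | h
    · exact absurd hi h.2.1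
    all_goals exact s1 hi
  · exact htop
  · exact absurd hi hK3
  · rcases hcases with h | h | h | h | h
    · exact absurd hi h.2.2.2.2
    · exact absurd hi h.2.2.2.2
    · exact absurd hi h.2.2.2.2
    · exact absurd hi h.2.2.2.2
    · exact s4 h.2.1 h.2.2.1 h.2.2.2.1 hi
  · rcases hcases with h | h | h | h | h
    · exact absurd hi h.2.2.2.1
    · exact absurd hi h.2.2.2.1
    · exact absurd hi h.2.2.2.1
    · exact s5 h.2.1 h.2.2.1 hi
    · exact s5 h.2.1 h.2.2.1 hi

include h₀ hPd hV in
/-- **The left faces of the walk are inside** (induction along the walk, through the fan at each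
head), provided the left face of `d₀` is. [folklore] -/
theorem leftFace_inside (hK : ∀ y : Site 2, (Finset.univ.filter fun k : Fin 6 => faceL y k ∈ K ∧ faceL y (k + 1) ∉ K).card ≤ 1)
    (hbase : triCellStrict (faceL d₀.1 d₀.2) ⊆ (polygonDomain (bverts K 0 1 d₀ Per) hs).carrier) :
    ∀ t : ℕ, triCellStrict (faceL (bwalk K d₀ t).1 (bwalk K d₀ t).2) ⊆ (polygonDomain (bverts K 0 1 d₀ Per) hs).carrier
  | 0 => hbase
  | t + 1 => by
    have IH := leftFace_inside hK hbase t
    have hdt := isBdDart_bwalk (K := K) h₀ t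
    rcases hxk : bwalk K d₀ t with ⟨x, k⟩
    rw [hxk] at IH hdt
    rw [bwalk_succ, hxk, (isBdDart_bsucc hdt).2]
    have htop : triCellStrict (faceL (x + triDir k) (k + 2)) ⊆ (polygonDomain (bverts K 0 1 d₀ Per) hs).carrier := by
      rw [(faceL_head x k).1]; exact IH
    have hm := (mem_bdDarts.1 (isBdDart_bsucc hdt).1).1
    rw [(isBdDart_bsucc hdt).2] at hm
    exact fan_inside_of_top hs h₀ hPd hV hK hdt htop _ hm

include h₀ hPd hV in
/-- **All `K`-faces at every vertex of the cycle are inside.** [folklore] -/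
theorem fan_inside (hK : ∀ y : Site 2, (Finset.univ.filter fun k : Fin 6 => faceL y k ∈ K ∧ faceL y (k + 1) ∉ K).card ≤ 1)
    (hbase : triCellStrict (faceL d₀.1 d₀.2) ⊆ (polygonDomain (bverts K 0 1 d₀ Per) hs).carrier) (t : ℕ) :
    ∀ i : Fin 6, faceL ((bwalk K d₀ t).1 + triDir (bwalk K d₀ t).2) i ∈ K →
      triCellStrict (faceL ((bwalk K d₀ t).1 + triDir (bwalk K d₀ t).2) i) ⊆
        (polygonDomain (bverts K 0 1 d₀ Per) hs).carrier := by
  have IH := leftFace_inside hs h₀ hPd hV hK hbase t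
  have hdt := isBdDart_bwalk (K := K) h₀ t
  rcases hxk : bwalk K d₀ t with ⟨x, k⟩
  rw [hxk] at IH hdt
  refine fan_inside_of_top hs h₀ hPd hV hK hdt ?_
  rw [(faceL_head x k).1]; exact IH

/-! ### 4. The non-`K` faces along the cycle are outside -/

omit hs h₀ hPd hV in
/-- The open cell is convex (positive barycentric coordinates are preserved by convex combinations).
[folklore] -/
theorem convex_triCellStrict (F : HexVertex) : Convex ℝ (triCellStrict F) := by
  intro z hz z' hz' a c ha hc hac j
  rw [Complex.real_smul, Complex.real_smul, Literature.Probability.Percolation.cellForm_lineComb F j hac]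
  rcases ha.lt_or_eq with ha' | rfl
  · exact add_pos_of_pos_of_nonneg (mul_pos ha' (hz j)) (mul_nonneg hc (hz' j).le)
  · simp only [zero_add] at hac; subst hac; simpa using hz' j

include h₀ hPd hV in
/-- **The right face of every dart of the cycle is outside**: its edge midpoint is on
`frontier V`, so outside points `q` accumulate there; by `edge_trichotomy` such a `q` is in the open
left cell (inside — impossible), on the edge (on `Γ` — impossible) or in the open right cell, which,
being convex and missing `Γ`, is then outside. [folklore] -/
theorem rightFace_outside (hK : ∀ y : Site 2, (Finset.univ.filter fun k : Fin 6 => faceL y k ∈ K ∧ faceL y (k + 1) ∉ K).card ≤ 1)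
    (hbase : triCellStrict (faceL d₀.1 d₀.2) ⊆ (polygonDomain (bverts K 0 1 d₀ Per) hs).carrier) (hP0 : 0 < Per) (t : ℕ) :
    triCellStrict (faceL (bwalk K d₀ t).1 ((bwalk K d₀ t).2 + 5)) ⊆ V := by
  have ht : t % Per < Per := Nat.mod_lt t hP0
  have hleft := leftFace_inside hs h₀ hPd hV hK hbase t
  rw [← bwalk_mod_period hPd t] at hleft ⊢
  set b := (bwalk K d₀ (t % Per)).1 with hb
  set m := (bwalk K d₀ (t % Per)).2 with hm
  set mid : ℂ := triEmbed b + ((1 / 2 : ℝ) : ℂ) * triEmbed (triDir m) with hmid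
  -- the midpoint is on the cycle
  have hseg : segment ℝ (triEmbed b) (triEmbed (b + triDir m)) ⊆ frontier (polygonDomain (bverts K 0 1 d₀ Per) hs).carrier :=
    fun z hz => (mem_frontier_iff hs h₀ hPd).2 ⟨t % Per, ht, hz⟩
  have hmidΓ : mid ∈ frontier (polygonDomain (bverts K 0 1 d₀ Per) hs).carrier := by
    apply hseg
    rw [segment_eq_image']
    refine ⟨1 / 2, ⟨by norm_num, by norm_num⟩, ?_⟩
    simp only [hmid, triEmbed_add, add_sub_cancel_left, Complex.real_smul]
  -- an outside point near the midpoint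
  have hmidV : mid ∈ closure V := by
    rw [closure_eq_self_union_frontier, hV.2.2.2]; exact Or.inr hmidΓ
  obtain ⟨q, hqb, hqV⟩ : (ball mid (1 / 16) ∩ V).Nonempty :=
    mem_closure_iff_nhds.1 hmidV _ (ball_mem_nhds _ (by norm_num))
  have hq : 4 * ‖q - mid‖ < min (1 / 2 : ℝ) (1 - 1 / 2) := by
    rw [mem_ball, dist_eq_norm] at hqb
    rw [show min (1 / 2 : ℝ) (1 - 1 / 2) = 1 / 2 by norm_num]
    linarith
  obtain ⟨hpos, hneg, hzero⟩ := edge_trichotomy b m (1 / 2) q hq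
  have hqΓ : q ∉ frontier (polygonDomain (bverts K 0 1 d₀ Per) hs).carrier := by
    rw [← hV.2.2.2]
    intro h
    have : q ∈ V ∩ frontier V := ⟨hqV, h⟩
    rw [hV.1.inter_frontier_eq] at this
    exact this
  rcases lt_trichotomy 0 ((q - mid) * conj (innerNormal (![0, 3, 5, 1, 2, 4] m))).re with h | h | h
  · -- inside: impossible
    exact absurd hqV (Set.disjoint_left.1 hV.2.1 (hleft (hpos h)))
  · exact absurd (hseg (hzero h.symm)) hqΓ
  · exact subset_outside_of_convex hs hV (convex_triCellStrict _)
      (triCellStrict_disjoint_frontier hs h₀ hPd _) ⟨q, hneg h, hqV⟩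

include h₀ hPd hV in
/-- **All non-`K` faces at every vertex of the cycle are outside.** [folklore] -/
theorem fan_outside (hK : ∀ y : Site 2, (Finset.univ.filter fun k : Fin 6 => faceL y k ∈ K ∧ faceL y (k + 1) ∉ K).card ≤ 1)
    (hbase : triCellStrict (faceL d₀.1 d₀.2) ⊆ (polygonDomain (bverts K 0 1 d₀ Per) hs).carrier) (hP0 : 0 < Per) (t : ℕ) :
    ∀ i : Fin 6, faceL ((bwalk K d₀ t).1 + triDir (bwalk K d₀ t).2) i ∉ K →
      triCellStrict (faceL ((bwalk K d₀ t).1 + triDir (bwalk K d₀ t).2) i) ⊆ V := by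
  have hR := rightFace_outside hs h₀ hPd hV hK hbase hP0 t
  have hdt := isBdDart_bwalk (K := K) h₀ t
  rcases hxk : bwalk K d₀ t with ⟨x, k⟩
  rw [hxk] at hR hdt
  simp only at hR ⊢
  set y := x + triDir k with hy
  obtain ⟨e11, -, e31, e41, e51, e0⟩ := fin6_succ k
  obtain ⟨hK2, hK3, hcases⟩ := fan_at_head hK hdt
  have h3 : triCellStrict (faceL y (k + 3)) ⊆ V := by rw [(faceL_head x k).2]; exact hR
  have s4 : faceL y (k + 4) ∉ K → triCellStrict (faceL y (k + 4)) ⊆ V :=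
    fun h4 => outside_step_up hs h₀ hPd hV y (k + 3) hK3 (by rw [e31]; exact h4) h3 |> fun h => by rw [e31] at h; exact h
  have s5 : faceL y (k + 4) ∉ K → faceL y (k + 5) ∉ K → triCellStrict (faceL y (k + 5)) ⊆ V :=
    fun h4 h5 => outside_step_up hs h₀ hPd hV y (k + 4) h4 (by rw [e41]; exact h5) (s4 h4) |> fun h => by rw [e41] at h; exact h
  have s0 : faceL y (k + 4) ∉ K → faceL y (k + 5) ∉ K → faceL y k ∉ K → triCellStrict (faceL y k) ⊆ V :=
    fun h4 h5 h0 => outside_step_up hs h₀ hPd hV y (k + 5) h5 (by rw [e51]; exact h0) (s5 h4 h5) |> fun h => by rw [e51] at h; exact h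
  have s1 : faceL y (k + 4) ∉ K → faceL y (k + 5) ∉ K → faceL y k ∉ K → faceL y (k + 1) ∉ K →
      triCellStrict (faceL y (k + 1)) ⊆ V :=
    fun h4 h5 h0 h1 => outside_step_up hs h₀ hPd hV y k h0 h1 (s0 h4 h5 h0)
  intro i hi
  obtain ⟨c, rfl⟩ : ∃ c : Fin 6, i = k + c := ⟨i - k, by abel⟩
  have hc : c = 0 ∨ c = 1 ∨ c = 2 ∨ c = 3 ∨ c = 4 ∨ c = 5 := by fin_cases c <;> simp
  rcases hc with rfl | rfl | rfl | rfl | rfl | rfl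
  · rw [e0] at hi ⊢
    rcases hcases with h | h | h | h | h
    · exact s0 h.2.2.2.2 h.2.2.2.1 hi
    · exact s0 h.2.2.2.2 h.2.2.2.1 hi
    · exact absurd h.2.2.1 hi
    · exact absurd h.2.2.1 hi
    · exact absurd h.2.2.1 hi
  · rcases hcases with h | h | h | h | h
    · exact s1 h.2.2.2.2 h.2.2.2.1 h.2.2.1 hi
    · exact absurd h.2.1 hi
    · exact absurd h.2.1 hi
    · exact absurd h.2.1 hi
    · exact absurd h.2.1 hi
  · exact absurd hK2 hi
  · exact h3
  · rcases hcases with h | h | h | h | h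
    · exact s4 hi
    · exact s4 hi
    · exact s4 hi
    · exact s4 hi
    · exact absurd h.2.2.2.2 hi
  · rcases hcases with h | h | h | h | h
    · exact s5 h.2.2.2.2 hi
    · exact s5 h.2.2.2.2 hi
    · exact s5 h.2.2.2.2 hi
    · exact absurd h.2.2.2.1 hi
    · exact absurd h.2.2.2.1 hi

end Sides

/-- **Open cells miss the boundary cycle** (registered form, sub-goal of `stub_innerZigzagPolygon`).
[folklore] -/
theorem open_cells_miss_cycle : ∀ (K : Finset HexVertex) (d₀ : Site 2 × Fin 6) (Per : ℕ) (hs : IsSimpleClosedPolygon (bverts K 0 1 d₀ Per)), d₀ ∈ bdDarts K → bwalk K d₀ Per = d₀ → ∀ G : HexVertex, Disjoint (triCellStrict G) (frontier (polygonDomain (bverts K 0 1 d₀ Per) hs).carrier) :=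
  fun _ _ _ hs h₀ hPd G => triCellStrict_disjoint_frontier hs h₀ hPd G

end Summit.CriticalPhenomena.SAWScalingLimit.Theorems.PolygonParitySqueeze.InnerZigzag

end
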